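import Summits.KontsevichZagierPeriods.KontsevichZagierPeriods.Theorems.RootDecompZetaThreeFrontierGZLadderFourPolarP04

/-! # `RootDecompZetaThreeFrontierGZLadderFourPolarP05` — part 5/12 of the mechanical ≤400-line split of `l4_src.lean` (sha256 5cc5a9ee4c47da9a…)
Source: decomp-kz lens-1 g13 Layer4_v1.lean @897236f9 minus the RungFour prelude block (imported from …RungFourPreludeP14); --supports stmt-KontsevichZagierPeriods-27141.
Split by census-1 g10 `gen/splitlean.py`: scopes re-opened with their `open`/`variable`/`set_option` context; mathematics and declaration order unchanged. -/

set_option linter.dupNamespace false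
noncomputable section
set_option linter.dupNamespace false
set_option linter.unusedVariables false
set_option linter.unusedSectionVars false
set_option linter.unusedSimpArgs false
open Set MeasureTheory MvPolynomial
open Literature.NumberTheory.Transcendental
open Summit.KontsevichZagierPeriods.KontsevichZagierPeriods.Theorems.RootDecompZetaThreeFrontierWordMoves
namespace Summit.KontsevichZagierPeriods.KontsevichZagierPeriods.Cruxes.GZNormalFormWThree.GZLadder.GapForm
set_option linter.unusedTactic false
set_option linter.unreachableTactic false
open MvPolynomial Finset Pointwise
open Summit.KontsevichZagierPeriods.KontsevichZagierPeriods.Cruxes.GZNormalFormWThree.GZLadder.RungFour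
open Summit.KontsevichZagierPeriods.KontsevichZagierPeriods.Cruxes.GZNormalFormWThree.GZLadder.WlogFour
open Summit.KontsevichZagierPeriods.KontsevichZagierPeriods.Cruxes.GZNormalFormWThree.GZLadder.MatchFour

/-- Auxiliary step `prod`: prod. [bookkeeping] -/
theorem WOrd.prod {G : Finset (Fin 5)} {ι : Type*} (s : Finset ι) (f : ι → MvPolynomial (Fin 5) ℚ) (n : ι → ℕ)
    (h : ∀ i ∈ s, WOrd G (n i) (f i)) : WOrd G (∑ i ∈ s, n i) (∏ i ∈ s, f i) := by
  classical
  induction s using Finset.induction_on with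
  | empty => simpa using wOrd_zero_left G (1 : MvPolynomial (Fin 5) ℚ)
  | insert a s ha ih =>
    rw [Finset.prod_insert ha, Finset.sum_insert ha]
    exact (h a (Finset.mem_insert_self a s)).mul (ih fun i hi => h i (Finset.mem_insert_of_mem hi))

/-- Auxiliary step `wOrd_X`: w Ord X. [bookkeeping] -/
theorem wOrd_X {G : Finset (Fin 5)} {i : Fin 5} (hi : i ∈ G) : WOrd G 1 (X i : MvPolynomial (Fin 5) ℚ) := by
  intro κ hκ
  rw [support_X, Finset.mem_singleton] at hκ
  subst hκ
  unfold wdeg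
  rw [Finset.sum_eq_single i (fun j _ hji => by rw [Finsupp.single_apply, if_neg (Ne.symm hji)]) (fun h => (h hi).elim)]
  simp

/-- the interval sums `y_a + ⋯ + y_b` of gap variables -/
def ivl (a b : ℕ) : MvPolynomial (Fin 5) ℚ := ∑ i : Fin 5, if a ≤ i.val ∧ i.val ≤ b then X i else 0

/-- Auxiliary step `ivl_eq`: ivl eq. [bookkeeping] -/
theorem ivl_eq (a b : ℕ) : ivl a b =
    (if a ≤ (0 : Fin 5).val ∧ (0 : Fin 5).val ≤ b then X 0 else 0) +
      (if a ≤ (1 : Fin 5).val ∧ (1 : Fin 5).val ≤ b then X 1 else 0) +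
      (if a ≤ (2 : Fin 5).val ∧ (2 : Fin 5).val ≤ b then X 2 else 0) +
      (if a ≤ (3 : Fin 5).val ∧ (3 : Fin 5).val ≤ b then X 3 else 0) +
      (if a ≤ (4 : Fin 5).val ∧ (4 : Fin 5).val ≤ b then X 4 else 0) := by
  rw [ivl, Fin.sum_univ_five]

/-- Auxiliary step `ivl_isHomogeneous`: ivl is Homogeneous. [bookkeeping] -/
theorem ivl_isHomogeneous (a b : ℕ) : (ivl a b).IsHomogeneous 1 :=
  IsHomogeneous.sum _ _ _ fun i _ => by
    by_cases h : a ≤ i.val ∧ i.val ≤ b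
    · rw [if_pos h]
      exact isHomogeneous_X ℚ i
    · rw [if_neg h]
      exact (homogeneousSubmodule (Fin 5) ℚ 1).zero_mem

/-- Auxiliary step `wOrd_ivl`: w Ord ivl. [bookkeeping] -/
theorem wOrd_ivl {G : Finset (Fin 5)} {a b : ℕ} (h : ∀ i : Fin 5, a ≤ i.val → i.val ≤ b → i ∈ G) :
    WOrd G 1 (ivl a b) :=
  WOrd.sum _ _ fun i _ => by
    by_cases hc : a ≤ i.val ∧ i.val ≤ b
    · rw [if_pos hc]
      exact wOrd_X (h i hc.1 hc.2)
    · rw [if_neg hc]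
      exact wOrd_zero G 1

/-! ### §E4 The chart construction of a homogeneous gap expansion -/

/-- Auxiliary step `isHomogeneous_sumX` (§E4): is Homogeneous sum X. [bookkeeping] -/
theorem isHomogeneous_sumX : (∑ i : Fin 5, X i : MvPolynomial (Fin 5) ℚ).IsHomogeneous 1 :=
  IsHomogeneous.sum _ _ _ fun i _ => isHomogeneous_X ℚ i

/-- from `q = Σ_e a_e u^e` (a chart expansion, `u_j = U_j(y)` linear forms in the gaps): `Σ_e a_e (Σy)^{D-|e|} ∏_j U_j^{e_j}` -/
def chartForm (U : Fin 4 → MvPolynomial (Fin 5) ℚ) (q : MvPolynomial (Fin 4) ℚ) (D : ℕ) : MvPolynomial (Fin 5) ℚ :=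
  ∑ e ∈ q.support, C (coeff e q) * (∑ i : Fin 5, X i) ^ (D - (e 0 + e 1 + e 2 + e 3)) * ∏ j, U j ^ e j

/-- Auxiliary step `chartForm_isHomogeneous` (§E4): chart Form is Homogeneous. [bookkeeping] -/
theorem chartForm_isHomogeneous (U : Fin 4 → MvPolynomial (Fin 5) ℚ) (q : MvPolynomial (Fin 4) ℚ) (D : ℕ)
    (hU : ∀ j, (U j).IsHomogeneous 1) (hD : ∀ e ∈ q.support, e 0 + e 1 + e 2 + e 3 ≤ D) :
    (chartForm U q D).IsHomogeneous D := by
  refine IsHomogeneous.sum _ _ _ fun e he => ?_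
  have h1 := isHomogeneous_sumX.pow (D - (e 0 + e 1 + e 2 + e 3))
  have h2 := IsHomogeneous.prod Finset.univ (fun j => U j ^ e j) (fun j => 1 * e j) fun j _ => (hU j).pow (e j)
  have h := (h1.mul h2).C_mul (coeff e q)
  have hdeg : 1 * (D - (e 0 + e 1 + e 2 + e 3)) + ∑ j ∈ (Finset.univ : Finset (Fin 4)), 1 * e j = D := by
    simp only [one_mul, Fin.sum_univ_four]
    have := hD e he
    omega
  rw [hdeg] at h
  simpa only [mul_assoc] using h

/-- Auxiliary step `bind₁_eq_sum` (§E4): bind₁ eq sum. [bookkeeping] -/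
theorem bind₁_eq_sum {σ : Type*} (T : Fin 4 → MvPolynomial σ ℚ) (q : MvPolynomial (Fin 4) ℚ) :
    bind₁ T q = ∑ e ∈ q.support, C (coeff e q) * ∏ j, T j ^ e j := by
  classical
  conv_lhs => rw [q.as_sum]
  rw [map_sum]
  refine Finset.sum_congr rfl fun e _ => ?_
  rw [bind₁_monomial, Finset.prod_subset (Finset.subset_univ e.support) (fun i _ hi => by
      rw [Finsupp.mem_support_iff, not_not] at hi
      rw [hi, pow_zero])]

/-- Auxiliary step `gapSub_chartForm` (§E4): gap Sub chart Form. [bookkeeping] -/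
theorem gapSub_chartForm (U : Fin 4 → MvPolynomial (Fin 5) ℚ) (T : Fin 4 → MvPolynomial (Fin 4) ℚ)
    (hUT : ∀ j, gapSub (U j) = T j) (q : MvPolynomial (Fin 4) ℚ) (D : ℕ) :
    gapSub (chartForm U q D) = bind₁ T q := by
  rw [bind₁_eq_sum, chartForm, map_sum]
  refine Finset.sum_congr rfl fun e _ => ?_
  rw [map_mul, map_mul, map_pow, gapSub_sumX, one_pow, mul_one, map_prod]
  simp only [map_pow, hUT]
  rw [show gapSub (C (coeff e q)) = C (coeff e q) from bind₁_C_right _ _]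

/-- Auxiliary step `chartForm` (§E4): chart Form. [bookkeeping] -/
theorem WOrd.chartForm {G : Finset (Fin 5)} (I : Finset (Fin 4)) {m : ℕ} (U : Fin 4 → MvPolynomial (Fin 5) ℚ)
    (q : MvPolynomial (Fin 4) ℚ) (D : ℕ) (hI : ∀ j ∈ I, WOrd G 1 (U j))
    (hq : ∀ e ∈ q.support, m ≤ ∑ j ∈ I, e j) : WOrd G m (chartForm U q D) := by
  classical
  refine WOrd.sum _ _ fun e he => ?_
  have hP : WOrd G (∑ j ∈ (Finset.univ : Finset (Fin 4)), if j ∈ I then e j else 0) (∏ j, U j ^ e j) :=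
    WOrd.prod _ _ _ fun j _ => by
      by_cases hj : j ∈ I
      · rw [if_pos hj]
        simpa using (hI j hj).pow (e j)
      · rw [if_neg hj]
        exact wOrd_zero_left G _
  rw [Finset.sum_ite_mem, Finset.univ_inter] at hP
  have h := ((wOrd_zero_left G (C (coeff e q))).mul
    (wOrd_zero_left G ((∑ i : Fin 5, X i) ^ (D - (e 0 + e 1 + e 2 + e 3))))).mul hP
  simp only [zero_add] at h
  exact h.mono (hq e he)

/-! ### §E5 The four charts: coordinates as interval sums of gaps -/

/-- `t = (y₁+y₂+y₃+y₄, y₂+y₃+y₄, y₃+y₄, y₄)` -/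
def Uid : Fin 4 → MvPolynomial (Fin 5) ℚ := ![ivl 1 4, ivl 2 4, ivl 3 4, ivl 4 4]
/-- `σ₄(t) = (1-t₃, 1-t₂, 1-t₁, 1-t₀) = (y₀+y₁+y₂+y₃, y₀+y₁+y₂, y₀+y₁, y₀)` -/
def Udu : Fin 4 → MvPolynomial (Fin 5) ℚ := ![ivl 0 3, ivl 0 2, ivl 0 1, ivl 0 0]
/-- `τ₀₁(t) = (t₀, t₀-t₃, t₀-t₂, t₀-t₁) = (y₁+y₂+y₃+y₄, y₁+y₂+y₃, y₁+y₂, y₁)` -/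
def U03 : Fin 4 → MvPolynomial (Fin 5) ℚ := ![ivl 1 4, ivl 1 3, ivl 1 2, ivl 1 1]
/-- `τ₁₂(t) = (t₀, t₁, t₁-t₃, t₁-t₂) = (y₁+y₂+y₃+y₄, y₂+y₃+y₄, y₂+y₃, y₂)` -/
def U13 : Fin 4 → MvPolynomial (Fin 5) ℚ := ![ivl 1 4, ivl 2 4, ivl 2 3, ivl 2 2]

/-- Auxiliary step `Uid_isHomogeneous` (§E5): Uid is Homogeneous. [bookkeeping] -/
theorem Uid_isHomogeneous : ∀ j, (Uid j).IsHomogeneous 1 := by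
  intro j; fin_cases j <;> exact ivl_isHomogeneous _ _
/-- Auxiliary step `Udu_isHomogeneous` (§E5): Udu is Homogeneous. [bookkeeping] -/
theorem Udu_isHomogeneous : ∀ j, (Udu j).IsHomogeneous 1 := by
  intro j; fin_cases j <;> exact ivl_isHomogeneous _ _
/-- Auxiliary step `U03_isHomogeneous` (§E5): U03 is Homogeneous. [bookkeeping] -/
theorem U03_isHomogeneous : ∀ j, (U03 j).IsHomogeneous 1 := by
  intro j; fin_cases j <;> exact ivl_isHomogeneous _ _
/-- Auxiliary step `U13_isHomogeneous` (§E5): U13 is Homogeneous. [bookkeeping] -/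
theorem U13_isHomogeneous : ∀ j, (U13 j).IsHomogeneous 1 := by
  intro j; fin_cases j <;> exact ivl_isHomogeneous _ _

/-- Auxiliary step `gapSub_Uid` (§E5): gap Sub Uid. [bookkeeping] -/
theorem gapSub_Uid : ∀ j, gapSub (Uid j) = (X j : MvPolynomial (Fin 4) ℚ) := by
  intro j
  fin_cases j <;> simp [Uid, ivl_eq, gapSub, gapsP, bind₁_X_right] <;> ring

/-- Auxiliary step `gapSub_Udu` (§E5): gap Sub Udu. [bookkeeping] -/
theorem gapSub_Udu : ∀ j, gapSub (Udu j) =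
    (![C 1 - X 3, C 1 - X 2, C 1 - X 1, C 1 - X 0] : Fin 4 → MvPolynomial (Fin 4) ℚ) j := by
  intro j
  fin_cases j <;> simp [Udu, ivl_eq, gapSub, gapsP, bind₁_X_right] <;> ring

/-- Auxiliary step `gapSub_U03` (§E5): gap Sub U03. [bookkeeping] -/
theorem gapSub_U03 : ∀ j, gapSub (U03 j) =
    (![X 0, X 0 - X 3, X 0 - X 2, X 0 - X 1] : Fin 4 → MvPolynomial (Fin 4) ℚ) j := by
  intro j
  fin_cases j <;> simp [U03, ivl_eq, gapSub, gapsP, bind₁_X_right] <;> ring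

/-- Auxiliary step `gapSub_U13` (§E5): gap Sub U13. [bookkeeping] -/
theorem gapSub_U13 : ∀ j, gapSub (U13 j) =
    (![X 0, X 1, X 1 - X 3, X 1 - X 2] : Fin 4 → MvPolynomial (Fin 4) ℚ) j := by
  intro j
  fin_cases j <;> simp [U13, ivl_eq, gapSub, gapsP, bind₁_X_right] <;> ring

/-! ### §E6 THEOREM E₄ -/

/-- a common degree bound for the four chart expansions -/
theorem degree_bound (q : MvPolynomial (Fin 4) ℚ) {D : ℕ} (hq : q.totalDegree ≤ D) :
    ∀ e ∈ q.support, e 0 + e 1 + e 2 + e 3 ≤ D := fun e he => by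
  have h := le_totalDegree he
  rw [Finsupp.sum_fintype _ _ (fun _ => rfl), Fin.sum_univ_four] at h
  exact h.trans hq

/-- **E₄ (gap form), PROVED.** -/
theorem gapFormFour : GapFormFour := by
  classical
  rintro r ⟨hd, p, β₀, β₁, β₂, γ₁, γ₂, γ₃, α₀₂, α₀₃, α₁₃, h1, h2, h3, h4, h5, h6, h7, h8, h9, hi⟩
  obtain ⟨D, bp, bdu, b03, b13⟩ : ∃ D, p.totalDegree ≤ D ∧ (du4P p).totalDegree ≤ D ∧ (s03P p).totalDegree ≤ D ∧
      (s13P p).totalDegree ≤ D :=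
    ⟨p.totalDegree + (du4P p).totalDegree + (s03P p).totalDegree + (s13P p).totalDegree, by omega, by omega, by omega,
      by omega⟩
  -- THE expansion, built in the identity chart
  set H := chartForm Uid p D with hH
  have hHh : H.IsHomogeneous D := chartForm_isHomogeneous _ _ _ Uid_isHomogeneous (degree_bound p bp)
  have hHsub : gapSub H = p := by
    rw [hH, gapSub_chartForm Uid X gapSub_Uid]
    exact AlgHom.congr_fun bind₁_X_left p
  -- the other three charts build the same `H`
  have Hdu : chartForm Udu (du4P p) D = H :=
    eq_of_gapSub_eq (chartForm_isHomogeneous _ _ _ Udu_isHomogeneous (degree_bound _ bdu)) hHh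
      (by rw [gapSub_chartForm Udu _ gapSub_Udu, hHsub]; exact du4P_du4P p)
  have H03 : chartForm U03 (s03P p) D = H :=
    eq_of_gapSub_eq (chartForm_isHomogeneous _ _ _ U03_isHomogeneous (degree_bound _ b03)) hHh
      (by rw [gapSub_chartForm U03 _ gapSub_U03, hHsub]; exact s03P_s03P p)
  have H13 : chartForm U13 (s13P p) D = H :=
    eq_of_gapSub_eq (chartForm_isHomogeneous _ _ _ U13_isHomogeneous (degree_bound _ b13)) hHh
      (by rw [gapSub_chartForm U13 _ gapSub_U13, hHsub]; exact s13P_s13P p)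
  refine ⟨β₀, β₁, β₂, γ₁, γ₂, γ₃, α₀₂, α₀₃, α₁₃, H, fun κ hκ => ?_, hd, fun t ht => ?_⟩
  · -- admissibility of every monomial of `H`: nine weight facts
    have W : ∀ (G : Finset (Fin 5)) (I : Finset (Fin 4)) (m : ℕ) (U : Fin 4 → MvPolynomial (Fin 5) ℚ)
        (q : MvPolynomial (Fin 4) ℚ), chartForm U q D = H → (∀ j ∈ I, WOrd G 1 (U j)) →
        (∀ e ∈ q.support, m ≤ ∑ j ∈ I, e j) → m ≤ wdeg G κ :=
      fun G I m U q hq hI hm => (WOrd.chartForm I U q D hI hm) κ (by rw [hq]; exact hκ)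
    have hIu : ∀ (G : Finset (Fin 5)) (U : Fin 4 → MvPolynomial (Fin 5) ℚ),
        (∀ j, WOrd G 1 (U j)) → ∀ j ∈ (Finset.univ : Finset (Fin 4)), WOrd G 1 (U j) := fun G U h j _ => h j
    have w1 := W {1, 2, 3, 4} Finset.univ (β₀ + β₁ + β₂ + α₀₂ + α₀₃ + α₁₃ - 3) Uid p rfl
      (hIu _ _ fun j => by fin_cases j <;> exact wOrd_ivl (by decide))
      (fun e he => by have := h1 e he; simp only [Fin.sum_univ_four]; omega)
    have w2 := W {2, 3, 4} {1, 2, 3} (β₁ + β₂ + α₁₃ - 2) Uid p rfl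
      (fun j hj => by fin_cases j <;> first | exact absurd hj (by decide) | exact wOrd_ivl (by decide))
      (fun e he => by have := h2 e he; rw [Finset.sum_insert (by decide), Finset.sum_insert (by decide), Finset.sum_singleton]; omega)
    have w3 := W {3, 4} {2, 3} (β₂ - 1) Uid p rfl
      (fun j hj => by fin_cases j <;> first | exact absurd hj (by decide) | exact wOrd_ivl (by decide))
      (fun e he => by have := h3 e he; rw [Finset.sum_insert (by decide), Finset.sum_singleton]; omega)
    have w4 := W {0, 1, 2, 3} Finset.univ (γ₁ + γ₂ + γ₃ + α₀₂ + α₀₃ + α₁₃ - 3) Udu (du4P p) Hdu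
      (hIu _ _ fun j => by fin_cases j <;> exact wOrd_ivl (by decide))
      (fun e he => by have := h4 e he; simp only [Fin.sum_univ_four]; omega)
    have w5 := W {0, 1, 2} {1, 2, 3} (γ₁ + γ₂ + α₀₂ - 2) Udu (du4P p) Hdu
      (fun j hj => by fin_cases j <;> first | exact absurd hj (by decide) | exact wOrd_ivl (by decide))
      (fun e he => by have := h5 e he; rw [Finset.sum_insert (by decide), Finset.sum_insert (by decide), Finset.sum_singleton]; omega)
    have w6 := W {0, 1} {2, 3} (γ₁ - 1) Udu (du4P p) Hdu
      (fun j hj => by fin_cases j <;> first | exact absurd hj (by decide) | exact wOrd_ivl (by decide))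
      (fun e he => by have := h6 e he; rw [Finset.sum_insert (by decide), Finset.sum_singleton]; omega)
    have w7 := W {1, 2} {2, 3} (α₀₂ - 1) U03 (s03P p) H03
      (fun j hj => by fin_cases j <;> first | exact absurd hj (by decide) | exact wOrd_ivl (by decide))
      (fun e he => by have := h7 e he; rw [Finset.sum_insert (by decide), Finset.sum_singleton]; omega)
    have w8 := W {1, 2, 3} {1, 2, 3} (α₀₂ + α₀₃ + α₁₃ - 2) U03 (s03P p) H03
      (fun j hj => by fin_cases j <;> first | exact absurd hj (by decide) | exact wOrd_ivl (by decide))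
      (fun e he => by have := h8 e he; rw [Finset.sum_insert (by decide), Finset.sum_insert (by decide), Finset.sum_singleton]; omega)
    have w9 := W {2, 3} {2, 3} (α₁₃ - 1) U13 (s13P p) H13
      (fun j hj => by fin_cases j <;> first | exact absurd hj (by decide) | exact wOrd_ivl (by decide))
      (fun e he => by have := h9 e he; rw [Finset.sum_insert (by decide), Finset.sum_singleton]; omega)
    simp [wdeg] at w1 w2 w3 w4 w5 w6 w7 w8 w9
    dsimp only [Admissible4]
    omega
  · rw [hi ht]
    dsimp only
    rw [← hHsub, aeval_gapSub, aeval_gaps_eq_sum, Finset.sum_div]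
    refine Finset.sum_congr rfl fun κ _ => ?_
    simp only [gapF4, Fin.prod_univ_five, gaps_zero, gaps_one, gaps_two, gaps_three, gaps_four, mul_div_assoc]

/-- **MATCH₄ ⟸ N₄ ∧ S₄** (E₄ discharged). -/
theorem match_four_of_orders_suff (hN : OrdersFour) (hS : GapClassIntegrableFour) :
    ∀ r : KZ.IntegralRep 4, IsReducedFour r → CongInto (layerFour ∪ gzLT 4) (KZ.of r) :=
  match_four_of hN gapFormFour hS

/-- **(A₄) ⟸ N₄ ∧ S₄ ∧ LAYER₄** — the polar reduction of rung 4 from its two ANALYTIC stubs and the layer step. -/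
theorem polarReduction_four_of_analysis (hN : OrdersFour) (hS : GapClassIntegrableFour)
    (h₅ : ∀ s : KZ.IntegralRep 4, IsLayerFour s → CongInto (cellGens 4 ∪ gzLT 4) (KZ.of s)) : PolarReduction 4 :=
  polarReduction_four_of_stubs hN gapFormFour hS h₅

end Summit.KontsevichZagierPeriods.KontsevichZagierPeriods.Cruxes.GZNormalFormWThree.GZLadder.GapForm

/-! # §N  N₄ = `OrdersFour` PROVED: the nine cluster orders of an integrable reduced datum of dimension 4 (decomp-kz lens-1 g13)

Port of the LANDED k = 3 necessity engine (`WordOrdersThreeP1–P2`: cube, vertex blow-up chart, swap, monomial lifts, face lemma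
on the cube, `vertex_order` / `edge_order`, `reduced_orders`) ONE DIMENSION UP.  The face lemma in dimension 4 (`WlogFour.face_lemma4`)
is already in this file (§W3).  New here: the open cube `(0,1)⁴`, the cubical blow-up chart
`Ψ(y) = (y₃, y₃y₀, y₃y₀y₁, y₃y₀y₁y₂)` of `Δ₄` (Jacobian `-y₃³y₀²y₁`), the two coordinate swaps `y₀ ↔ y₃`, `y₁ ↔ y₃` of the cube
(edge chart = codimension-3 cluster `t₁,t₂,t₃ → 0`, face chart = codimension-2 cluster `t₂,t₃ → 0`), the three lifts of exponents,
the three order theorems, and the nine orders of `rf4` read through `du4`, `s03`, `s13` (§W6). -/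

namespace Summit.KontsevichZagierPeriods.KontsevichZagierPeriods.Cruxes.GZNormalFormWThree.GZLadder.OrdFour

open Summit.KontsevichZagierPeriods.KontsevichZagierPeriods.Cruxes.GZNormalFormWThree.GZLadder.RungFour
open Summit.KontsevichZagierPeriods.KontsevichZagierPeriods.Cruxes.GZNormalFormWThree.GZLadder.WlogFour
open Summit.KontsevichZagierPeriods.KontsevichZagierPeriods.Cruxes.GZNormalFormWThree.GZLadder.MatchFour
open Summit.KontsevichZagierPeriods.KontsevichZagierPeriods.Cruxes.GZNormalFormWThree.GZLadder.GapForm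

/-! ### §N1 The open cube `(0,1)⁴`, its sections over `Cube3`, the face lemma on the cube -/

/-- the open unit cube `(0,1)⁴` -/
def Cube4 : Set (Fin 4 → ℝ) :=
  {y | 0 < y 0 ∧ y 0 < 1 ∧ 0 < y 1 ∧ y 1 < 1 ∧ 0 < y 2 ∧ y 2 < 1 ∧ 0 < y 3 ∧ y 3 < 1}

/-- Auxiliary step `isOpen_Cube4` (§N1): is Open Cube4. [bookkeeping] -/
theorem isOpen_Cube4 : IsOpen Cube4 := by
  have h0 : Continuous fun y : Fin 4 → ℝ => y 0 := continuous_apply 0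
  have h1 : Continuous fun y : Fin 4 → ℝ => y 1 := continuous_apply 1
  have h2 : Continuous fun y : Fin 4 → ℝ => y 2 := continuous_apply 2
  have h3 : Continuous fun y : Fin 4 → ℝ => y 3 := continuous_apply 3
  simp only [Cube4, Set.setOf_and]
  exact (isOpen_lt continuous_const h0).inter ((isOpen_lt h0 continuous_const).inter
    ((isOpen_lt continuous_const h1).inter ((isOpen_lt h1 continuous_const).inter
    ((isOpen_lt continuous_const h2).inter ((isOpen_lt h2 continuous_const).inter
    ((isOpen_lt continuous_const h3).inter (isOpen_lt h3 continuous_const)))))))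

/-- Auxiliary step `measurableSet_Cube4` (§N1): measurable Set Cube4. [bookkeeping] -/
theorem measurableSet_Cube4 : MeasurableSet Cube4 := isOpen_Cube4.measurableSet

/-- Auxiliary step `cube3_nonempty` (§N1): cube3 nonempty. [bookkeeping] -/
theorem cube3_nonempty : Cube3.Nonempty := ⟨fun _ => 1 / 2, by norm_num [Cube3]⟩

/-- Auxiliary step `snoc_section_Cube4` (§N1): snoc section Cube4. [bookkeeping] -/
theorem snoc_section_Cube4 {x : Fin 3 → ℝ} (hx : x ∈ Cube3) :
    {s : ℝ | (Fin.snoc x s : Fin 4 → ℝ) ∈ Cube4} = Ioo 0 1 := by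
  obtain ⟨h0, h01, h1, h11, h2, h21⟩ := hx
  ext s
  simp only [mem_setOf_eq, Cube4, snoc3_zero, snoc3_one, snoc3_two, snoc3_three, mem_Ioo]
  exact ⟨fun h => ⟨h.2.2.2.2.2.2.1, h.2.2.2.2.2.2.2⟩, fun h => ⟨h0, h01, h1, h11, h2, h21, h.1, h.2⟩⟩

/-- **the face lemma on the cube `(0,1)⁴`** (face `y₃ = 0`, base the open cube `(0,1)³`): §W3 instantiated -/
theorem cube_face4 (D : (Fin 4 → ℝ) → ℝ) (hDc : ∀ x ∈ Cube3, ContinuousAt (fun s : ℝ => D (Fin.snoc x s)) 0)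
    (hD0 : ∀ x ∈ Cube3, D (Fin.snoc x (0:ℝ)) ≠ 0) (b : ℕ) (L : MvPolynomial (Fin 4) ℚ)
    (h : IntegrableOn (fun y => MvPolynomial.aeval y L / (y 3 ^ b * D y)) Cube4) : ∀ e ∈ L.support, b ≤ e 3 :=
  face_lemma4 measurableSet_Cube4 (fun _ hy => hy.2.2.2.2.2.2.1.ne') isOpen_Cube3 cube3_nonempty (fun _ => 1)
    (fun _ hx => snoc_section_Cube4 hx) (fun _ _ => ⟨one_pos, le_rfl⟩) D hDc hD0 b L h

/-! ### §N2 The cubical blow-up chart `Ψ(y) = (y₃, y₃y₀, y₃y₀y₁, y₃y₀y₁y₂)` of `Δ₄` -/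

/-- the VERTEX CHART of `Δ₄`: the open cube onto `Δ₄`, the face `y₃ = 0` onto the vertex `(0,0,0,0)` -/
def cΨ (y : Fin 4 → ℝ) : Fin 4 → ℝ := ![y 3, y 3 * y 0, y 3 * y 0 * y 1, y 3 * y 0 * y 1 * y 2]

/-- Auxiliary step `cΨ_zero` (§N2): cΨ zero. [bookkeeping] -/
@[simp] theorem cΨ_zero (y : Fin 4 → ℝ) : cΨ y 0 = y 3 := rfl
/-- Auxiliary step `cΨ_one` (§N2): cΨ one. [bookkeeping] -/
@[simp] theorem cΨ_one (y : Fin 4 → ℝ) : cΨ y 1 = y 3 * y 0 := rfl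
/-- Auxiliary step `cΨ_two` (§N2): cΨ two. [bookkeeping] -/
@[simp] theorem cΨ_two (y : Fin 4 → ℝ) : cΨ y 2 = y 3 * y 0 * y 1 := rfl
/-- Auxiliary step `cΨ_three` (§N2): cΨ three. [bookkeeping] -/
@[simp] theorem cΨ_three (y : Fin 4 → ℝ) : cΨ y 3 = y 3 * y 0 * y 1 * y 2 := rfl

/-- Auxiliary step `continuous_cΨ` (§N2): continuous cΨ. [bookkeeping] -/
theorem continuous_cΨ : Continuous cΨ := by
  refine continuous_pi fun i => ?_
  fin_cases i
  · show Continuous fun y : Fin 4 → ℝ => cΨ y 0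
    simp only [cΨ_zero]
    fun_prop
  · show Continuous fun y : Fin 4 → ℝ => cΨ y 1
    simp only [cΨ_one]
    fun_prop
  · show Continuous fun y : Fin 4 → ℝ => cΨ y 2
    simp only [cΨ_two]
    fun_prop
  · show Continuous fun y : Fin 4 → ℝ => cΨ y 3
    simp only [cΨ_three]
    fun_prop

/-- the Jacobian matrix of `Ψ` -/
def cJ (y : Fin 4 → ℝ) : Matrix (Fin 4) (Fin 4) ℝ :=
  !![0, 0, 0, 1;
     y 3, 0, 0, y 0;
     y 3 * y 1, y 3 * y 0, 0, y 0 * y 1;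
     y 3 * y 1 * y 2, y 3 * y 0 * y 2, y 3 * y 0 * y 1, y 0 * y 1 * y 2]

/-- `DΨ(y)` as a continuous linear map -/
def cD (y : Fin 4 → ℝ) : (Fin 4 → ℝ) →L[ℝ] (Fin 4 → ℝ) := LinearMap.toContinuousLinearMap (Matrix.toLin' (cJ y))

/-- Auxiliary step `cD_apply` (§N2): c D apply. [bookkeeping] -/
theorem cD_apply (y v : Fin 4 → ℝ) : cD y v = (cJ y).mulVec v := rfl

set_option maxHeartbeats 1600000 in
/-- Auxiliary step `det_cJ` (§N2): det c J. [bookkeeping] -/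
theorem det_cJ (y : Fin 4 → ℝ) : (cJ y).det = -(y 3 ^ 3 * y 0 ^ 2 * y 1) := by
  have e32 : Fin.succAbove (3 : Fin 4) (2 : Fin 3) = 2 := by decide
  simp [cJ, Matrix.det_succ_row_zero, Fin.sum_univ_succ, e32]
  ring

/-- Auxiliary step `det_cD` (§N2): det c D. [bookkeeping] -/
theorem det_cD (y : Fin 4 → ℝ) : (cD y).det = -(y 3 ^ 3 * y 0 ^ 2 * y 1) := by
  rw [← det_cJ]
  exact LinearMap.det_toLin' _

end Summit.KontsevichZagierPeriods.KontsevichZagierPeriods.Cruxes.GZNormalFormWThree.GZLadder.OrdFour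
end
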